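import Mathlib
import Summits.Ventures.HodgeRepro2.T5ConductorUnramifiedPlace
import Summits.Ventures.HodgeRepro2.T5RecordSatakeCyclotomicDiscriminant

/-!
# A CONTINUOUS ADDITIVE CHARACTER OF CONDUCTOR EXPONENT `0` EXISTS ON EVERY LOCAL FIELD OF THE RECORD

Tier-5 support N3 / §G-N4.2 (seat p3, gen 84). File 325 (`T5ConductorUnramifiedPlace`) proves clause (u2) of
§N3.10.3 for EVERY continuous non-trivial `ψ : ℚ_p → S¹` of conductor exponent `0`; the annex (§88) attributed the
EXISTENCE of such a `ψ_p` to seat p4's `T5ConductorExistence` — an erratum: that file is about multiplicative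
characters (A10). This file supplies the existence in kernel, so that the quantifier of 325 is inhabited
(README §10.5 (ii)(c): no statement of the lane quantifies over an empty carrier):

* **`exists_addChar_forall_le_one_and_ne_one`** — on a field `K` with a valuation `v : K → ℤᵐ⁰` and an element
  `x₀` with `1 < v x₀`, there is `ψ : K → S¹` additive, trivial on the valuation ring `{v ≤ 1}` and with `ψ x₀ ≠ 1`
  (Mathlib's `CharacterModule.exists_character_apply_ne_zero_of_ne_zero` on the discrete group `K / {v ≤ 1}`,
  composed with `ℚ/ℤ ↪ ℝ/ℤ ↪ S¹`);
* **`continuous_of_forall_le_one`** — an additive character trivial on `{v ≤ 1}` is locally constant, hence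
  continuous for the valuation topology (`Valued.mem_nhds`);
* **`exists_continuous_addChar_conductorExp_eq_zero`** — with `v x₀ = exp 1`: a continuous non-trivial `ψ` with
  `n(ψ) = 0` (p4's `conductorExp_eq_of`); **`…_adicCompletion`** — on the completion `K_v` of the fraction field
  of any Dedekind domain at any height-one prime (`x₀ = ϖ⁻¹`, p4's `exists_irreducible_val_eq_exp_neg_one`);
* **`exists_addChar_conductorExp_comp_trace_eq_zero`** / **`…_cm`** — THE WITNESS OF FILE 325: for every number
  field `F` (for the record `F = K⁺`, `K` any CM field) and every place `v ∤ disc F` (resp. `disc K ∉ v`) above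
  `v_p`, some continuous non-trivial `ψ : ℚ_p → S¹` has `n(ψ) = 0` AND `n(ψ ∘ Tr_{F_v/ℚ_p}) = 0`;
* **`exists_addChar_conductorExp_comp_trace_eq_zero_seven`** — the numeral: `K = ℚ(ζ₇)` (the brief's sextic
  Galois CM field, `disc K = −7⁵`, file 323), every place `v` of `K⁺` with `7 ∉ v`.

Nothing here is a statement about (P), theta lifts or L-values. §8(d): uses an L-value-free non-vanishing
device: NO.
-/

open IsDedekindDomain IsDedekindDomain.HeightOneSpectrum NumberField
open Summit.Ventures.HodgeRepro2.T5AdditiveConductor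

namespace Summit.Ventures.HodgeRepro2.T5ConductorZeroCharacter

section RationalCircle

/-- **`ℚ/ℤ → ℝ/ℤ`**: the additive map induced by the cast `ℚ → ℝ` on the circles `AddCircle (1 : ℚ)` and
`AddCircle (1 : ℝ)`. -/
noncomputable def ratAddCircleToReal : AddCircle (1 : ℚ) →+ AddCircle (1 : ℝ) :=
  QuotientAddGroup.map _ _ (Rat.castHom ℝ).toAddMonoidHom (by
    intro x hx
    rw [AddSubgroup.mem_comap]
    obtain ⟨n, rfl⟩ := AddSubgroup.mem_zmultiples_iff.mp hx
    refine AddSubgroup.mem_zmultiples_iff.mpr ⟨n, ?_⟩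
    simp)

/-- `ℚ/ℤ → ℝ/ℤ` on the class of `q : ℚ` is the class of `(q : ℝ)`. -/
theorem ratAddCircleToReal_coe (q : ℚ) :
    ratAddCircleToReal (q : AddCircle (1 : ℚ)) = ((q : ℝ) : AddCircle (1 : ℝ)) :=
  rfl

/-- **`ℚ/ℤ → ℝ/ℤ` is injective** (`n • 1 = q` in `ℝ` forces `q = n` in `ℚ`). -/
theorem ratAddCircleToReal_injective : Function.Injective ratAddCircleToReal := by
  rw [injective_iff_map_eq_zero]
  intro x hx
  induction x using QuotientAddGroup.induction_on with
  | H q =>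
    rw [ratAddCircleToReal_coe, AddCircle.coe_eq_zero_iff] at hx
    obtain ⟨n, hn⟩ := hx
    rw [AddCircle.coe_eq_zero_iff]
    refine ⟨n, ?_⟩
    have : ((n : ℚ) : ℝ) = (q : ℝ) := by simpa using hn
    have hq : (n : ℚ) = q := Rat.cast_injective this
    simpa using hq

/-- **`ℚ/ℤ → S¹`**: `ℚ/ℤ ↪ ℝ/ℤ` followed by Mathlib's `AddCircle.toCircle`. -/
noncomputable def ratAddCircleToCircle (x : AddCircle (1 : ℚ)) : Circle :=
  AddCircle.toCircle (ratAddCircleToReal x)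

/-- `ℚ/ℤ → S¹` sends `0` to `1`. -/
theorem ratAddCircleToCircle_zero : ratAddCircleToCircle 0 = 1 := by
  simp [ratAddCircleToCircle]

/-- `ℚ/ℤ → S¹` is multiplicative: `x + y ↦ (image of x) · (image of y)`. -/
theorem ratAddCircleToCircle_add (x y : AddCircle (1 : ℚ)) :
    ratAddCircleToCircle (x + y) = ratAddCircleToCircle x * ratAddCircleToCircle y := by
  simp [ratAddCircleToCircle, AddCircle.toCircle_add]

/-- **`ℚ/ℤ → S¹` is injective**; in particular it sends non-zero classes to `≠ 1`. -/
theorem ratAddCircleToCircle_ne_one {x : AddCircle (1 : ℚ)} (hx : x ≠ 0) : ratAddCircleToCircle x ≠ 1 := by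
  intro h
  apply hx
  apply ratAddCircleToReal_injective
  rw [map_zero]
  apply AddCircle.injective_toCircle (one_ne_zero : (1 : ℝ) ≠ 0)
  rw [AddCircle.toCircle_zero]
  exact h

end RationalCircle

section Valued

variable {K : Type*} [Field K] [Valued K (WithZero (Multiplicative ℤ))]

/-- **An additive character trivial on the valuation ring and non-trivial at a given `x₀` with `1 < v x₀`**
(Mathlib's `CharacterModule.exists_character_apply_ne_zero_of_ne_zero` on the quotient group `K / {v ≤ 1}`,
composed with `ℚ/ℤ → S¹`). -/
theorem exists_addChar_forall_le_one_and_ne_one (x₀ : K) (hx₀ : 1 < Valued.v x₀) :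
    ∃ ψ : AddChar K Circle, (∀ x, Valued.v x ≤ 1 → ψ x = 1) ∧ ψ x₀ ≠ 1 := by
  let O : AddSubgroup K := (Valued.v : Valuation K (WithZero (Multiplicative ℤ))).leAddSubgroup 1
  have hmem : ∀ x, x ∈ O ↔ Valued.v x ≤ 1 := fun x => Iff.rfl
  let π : K →+ K ⧸ O := QuotientAddGroup.mk' O
  have hq : π x₀ ≠ 0 := by
    intro h
    have : x₀ ∈ O := (QuotientAddGroup.eq_zero_iff x₀).mp h
    exact hx₀.not_ge ((hmem x₀).mp this)
  obtain ⟨c, hc⟩ := CharacterModule.exists_character_apply_ne_zero_of_ne_zero hq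
  refine ⟨{ toFun := fun x => ratAddCircleToCircle (c (π x))
            map_zero_eq_one' := by simp [ratAddCircleToCircle_zero]
            map_add_eq_mul' := by
              intro a b
              simp only [map_add, ratAddCircleToCircle_add] }, ?_, ?_⟩
  · intro x hx
    have hx0 : π x = 0 := (QuotientAddGroup.eq_zero_iff x).mpr ((hmem x).mpr hx)
    show ratAddCircleToCircle (c (π x)) = 1
    rw [hx0, map_zero, ratAddCircleToCircle_zero]
  · show ratAddCircleToCircle (c (π x₀)) ≠ 1
    exact ratAddCircleToCircle_ne_one hc

/-- **An additive character trivial on `{v ≤ 1}` is continuous** for the valuation topology: it is constant on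
the open cosets `x + {v ≤ 1}` (`Valued.mem_nhds` with `γ = 1`). -/
theorem continuous_of_forall_le_one (ψ : AddChar K Circle) (h : ∀ x, Valued.v x ≤ 1 → ψ x = 1) :
    Continuous ψ := by
  apply IsLocallyConstant.continuous
  rw [IsLocallyConstant.iff_eventually_eq]
  intro x
  rw [Filter.Eventually, Valued.mem_nhds]
  refine ⟨1, ?_⟩
  intro y hy
  have hy' : Valued.v (y - x) ≤ 1 := le_of_lt (by simpa using hy)
  show ψ y = ψ x
  have : y = x + (y - x) := by ring
  rw [this, AddChar.map_add_eq_mul, h _ hy', mul_one]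

/-- **A continuous non-trivial additive character of conductor exponent `0`** exists as soon as some `x₀` has
`v x₀ = exp 1` (p4's `conductorExp_eq_of`: trivial on `{v ≤ exp 0}`, not on `{v ≤ exp 1}`). -/
theorem exists_continuous_addChar_conductorExp_eq_zero (x₀ : K) (hx₀ : Valued.v x₀ = WithZero.exp 1) :
    ∃ ψ : AddChar K Circle, Continuous ψ ∧ (∃ y, ψ y ≠ 1) ∧
      conductorExp ψ (Valued.v : Valuation K (WithZero (Multiplicative ℤ))) = 0 := by
  have h1 : 1 < Valued.v x₀ := by
    rw [hx₀, ← WithZero.exp_zero]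
    exact WithZero.exp_lt_exp.mpr zero_lt_one
  obtain ⟨ψ, hψ0, hψx₀⟩ := exists_addChar_forall_le_one_and_ne_one x₀ h1
  refine ⟨ψ, continuous_of_forall_le_one ψ hψ0, ⟨x₀, hψx₀⟩, ?_⟩
  apply conductorExp_eq_of ψ Valued.v 0
  · intro x hx
    exact hψ0 x (by simpa using hx)
  · intro hall
    apply hψx₀
    apply hall x₀
    rw [hx₀, zero_add]
  · exact ⟨x₀, hψx₀⟩

end Valued

section AdicCompletion

variable {R : Type*} [CommRing R] [IsDedekindDomain R] {K : Type*} [Field K] [Algebra R K] [IsFractionRing R K]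
variable (v : HeightOneSpectrum R)

/-- **`K_v` has an element of valuation `exp 1`** (the inverse of a uniformiser, p4's
`exists_irreducible_val_eq_exp_neg_one`). -/
theorem exists_val_eq_exp_one : ∃ x : v.adicCompletion K, Valued.v x = WithZero.exp 1 := by
  obtain ⟨ϖ, -, hϖ⟩ :=
    Summit.Ventures.HodgeRepro2.T5AdicCompletionConductor.exists_irreducible_val_eq_exp_neg_one (K := K) v
  refine ⟨((ϖ : v.adicCompletionIntegers K) : v.adicCompletion K)⁻¹, ?_⟩
  rw [map_inv₀, hϖ, ← WithZero.exp_neg, neg_neg]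

/-- **On every completion `K_v`** (Dedekind domain `R`, fraction field `K`, height-one prime `v`) there is a
continuous non-trivial additive character `ψ : K_v → S¹` with `n(ψ) = 0`: trivial on `𝒪_v`, not on `ϖ⁻¹𝒪_v`. -/
theorem exists_continuous_addChar_conductorExp_eq_zero_adicCompletion :
    ∃ ψ : AddChar (v.adicCompletion K) Circle, Continuous ψ ∧ (∃ y, ψ y ≠ 1) ∧
      conductorExp ψ (Valued.v : Valuation (v.adicCompletion K) (WithZero (Multiplicative ℤ))) = 0 := by
  obtain ⟨x₀, hx₀⟩ := exists_val_eq_exp_one (K := K) v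
  exact exists_continuous_addChar_conductorExp_eq_zero x₀ hx₀

end AdicCompletion

section Witness

variable {F : Type*} [Field F] [NumberField F]
variable (vp : HeightOneSpectrum (𝓞 ℚ)) (v : HeightOneSpectrum (𝓞 F)) [hv : v.asIdeal.LiesOver vp.asIdeal]

include hv in
/-- **THE WITNESS OF CLAUSE (u2) FOR A NUMBER FIELD `F`**: at every place `v` of `F` with `disc F ∉ v`, above the
place `v_p` of `ℚ`, some continuous non-trivial `ψ : ℚ_p → S¹` has `n(ψ) = 0` and `n(ψ ∘ Tr_{F_v/ℚ_p}) = 0`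
(file 325's `conductorExp_comp_trace_eq_of_discr_notMem` on the character of
`exists_continuous_addChar_conductorExp_eq_zero_adicCompletion`). -/
theorem exists_addChar_conductorExp_comp_trace_eq_zero (h : ((discr F : ℤ) : 𝓞 F) ∉ v.asIdeal) :
    ∃ ψ : AddChar (vp.adicCompletion ℚ) Circle, Continuous ψ ∧ (∃ y, ψ y ≠ 1) ∧
      conductorExp ψ (Valued.v : Valuation (vp.adicCompletion ℚ) (WithZero (Multiplicative ℤ))) = 0 ∧
      conductorExp (ψ.compAddMonoidHom
        (Algebra.trace (vp.adicCompletion ℚ) (v.adicCompletion F)).toAddMonoidHom)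
        (Valued.v : Valuation (v.adicCompletion F) (WithZero (Multiplicative ℤ))) = 0 := by
  obtain ⟨ψ, hψ, hne, h0⟩ := exists_continuous_addChar_conductorExp_eq_zero_adicCompletion (K := ℚ) vp
  refine ⟨ψ, hψ, hne, h0, ?_⟩
  rw [Summit.Ventures.HodgeRepro2.T5ConductorUnramifiedPlace.conductorExp_comp_trace_eq_of_discr_notMem vp v h ψ
    hψ hne, h0]

end Witness

section CM

variable (K : Type*) [Field K] [NumberField K]
variable (vp : HeightOneSpectrum (𝓞 ℚ)) (v : HeightOneSpectrum (𝓞 (maximalRealSubfield K)))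
  [hv : v.asIdeal.LiesOver vp.asIdeal]

include hv in
/-- **THE WITNESS FOR THE RECORD — `F = K⁺`, `K` any CM field, outside `disc K`**: at every place `v` of `K⁺` with
`disc K ∉ v` there is a continuous non-trivial `ψ : ℚ_p → S¹` with `n(ψ) = 0` and `n(ψ ∘ Tr_{K⁺_v/ℚ_p}) = 0`
(the quantifier of file 325's `conductorExp_comp_trace_eq_zero_of_discr_notMem_cm` is inhabited). -/
theorem exists_addChar_conductorExp_comp_trace_eq_zero_cm
    (h : ((discr K : ℤ) : 𝓞 (maximalRealSubfield K)) ∉ v.asIdeal) :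
    ∃ ψ : AddChar (vp.adicCompletion ℚ) Circle, Continuous ψ ∧ (∃ y, ψ y ≠ 1) ∧
      conductorExp ψ (Valued.v : Valuation (vp.adicCompletion ℚ) (WithZero (Multiplicative ℤ))) = 0 ∧
      conductorExp (ψ.compAddMonoidHom
        (Algebra.trace (vp.adicCompletion ℚ) (v.adicCompletion (maximalRealSubfield K))).toAddMonoidHom)
        (Valued.v : Valuation (v.adicCompletion (maximalRealSubfield K)) (WithZero (Multiplicative ℤ))) = 0 := by
  obtain ⟨ψ, hψ, hne, h0⟩ := exists_continuous_addChar_conductorExp_eq_zero_adicCompletion (K := ℚ) vp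
  exact ⟨ψ, hψ, hne, h0,
    Summit.Ventures.HodgeRepro2.T5ConductorUnramifiedPlace.conductorExp_comp_trace_eq_zero_of_discr_notMem_cm K vp v
      h ψ hψ hne h0⟩

end CM

section Seven

variable (K : Type*) [Field K] [NumberField K] [IsCyclotomicExtension {7} ℚ K]
variable (vp : HeightOneSpectrum (𝓞 ℚ)) (v : HeightOneSpectrum (𝓞 (maximalRealSubfield K)))
  [hv : v.asIdeal.LiesOver vp.asIdeal]

/-- **`disc ℚ(ζ₇) ∉ v` at every place `v` of `ℚ(ζ₇)⁺` with `7 ∉ v`** (`disc = −7⁵`, file 323's `discr_seven`;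
`v` is prime). -/
theorem discr_seven_notMem (h7 : (7 : 𝓞 (maximalRealSubfield K)) ∉ v.asIdeal) :
    ((discr K : ℤ) : 𝓞 (maximalRealSubfield K)) ∉ v.asIdeal := by
  intro hmem
  have hd : discr K = -16807 :=
    Summit.Ventures.HodgeRepro2.T5RecordSatakeCyclotomicDiscriminant.discr_seven K
  rw [hd] at hmem
  have h75 : ((-16807 : ℤ) : 𝓞 (maximalRealSubfield K)) = -(7 : 𝓞 (maximalRealSubfield K)) ^ 5 := by
    norm_num
  rw [h75, Ideal.neg_mem_iff] at hmem
  exact h7 (v.isPrime.mem_of_pow_mem 5 hmem)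

include hv in
/-- **THE NUMERAL WITNESS — `K = ℚ(ζ₇)`** (the brief's sextic Galois CM field, `K⁺ = ℚ(ζ₇)⁺` cubic): at every
place `v` of `K⁺` with `7 ∉ v`, above `v_p`, some continuous non-trivial `ψ : ℚ_p → S¹` has `n(ψ) = 0` and
`n(ψ ∘ Tr_{K⁺_v/ℚ_p}) = 0`. -/
theorem exists_addChar_conductorExp_comp_trace_eq_zero_seven (h7 : (7 : 𝓞 (maximalRealSubfield K)) ∉ v.asIdeal) :
    ∃ ψ : AddChar (vp.adicCompletion ℚ) Circle, Continuous ψ ∧ (∃ y, ψ y ≠ 1) ∧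
      conductorExp ψ (Valued.v : Valuation (vp.adicCompletion ℚ) (WithZero (Multiplicative ℤ))) = 0 ∧
      conductorExp (ψ.compAddMonoidHom
        (Algebra.trace (vp.adicCompletion ℚ) (v.adicCompletion (maximalRealSubfield K))).toAddMonoidHom)
        (Valued.v : Valuation (v.adicCompletion (maximalRealSubfield K)) (WithZero (Multiplicative ℤ))) = 0 :=
  exists_addChar_conductorExp_comp_trace_eq_zero_cm K vp v (discr_seven_notMem K v h7)

end Seven

end Summit.Ventures.HodgeRepro2.T5ConductorZeroCharacter
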